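import Summits.HodgeConjecture.HodgeCM.PerL34.RestrictedTensor_1

/-! PORT of `HodgeCM/PerL34/RestrictedTensor.lean` (HodgeCMPerL run 82) — part 2: continuation of `Summits.HodgeConjecture.HodgeCM.PerL34.RestrictedTensor_1` (split at a top-level declaration boundary by port_pkg.py; scope re-opened below; declarations unchanged). -/

-- port_pkg: scope re-opened for this part (file-level context, then the namespace/section stack open at the cut)
set_option autoImplicit false
noncomputable section
open Function Set Filter HodgeCM.PerL34.NoSmallSubgroups
open scoped InnerProductSpace ComplexConjugate RestrictedProduct
namespace HodgeCM.PerL34.RestrictedTensor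
universe u v
variable {ι : Type u} {H : ι → Type v} [∀ i, NormedAddCommGroup (H i)]
  [∀ i, InnerProductSpace ℂ (H i)]
variable (𝓔 : UnitFamily H)
open RVec
variable {𝓔}
section slot
variable [DecidableEq ι]
/-- (Ported verbatim from the HodgeCMPerL package; no docstring in the source.) -/
theorem kOff_update_left (i : ι) (x y : RVec 𝓔) (v : H i) :
    kOff i (x.update i v) y = kOff i x y :=
  finprod_congr fun j => finprod_congr fun hj => by rw [RVec.update_apply_of_ne _ hj]

/-- (Ported verbatim from the HodgeCMPerL package; no docstring in the source.) -/
theorem inner_tp_tp_update (x y : RVec 𝓔) (i : ι) (v : H i) :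
    ⟪tp 𝓔 x, tp 𝓔 (y.update i v)⟫_ℂ = ⟪x i, v⟫_ℂ * kOff i x y := by
  rw [inner_tp_tp, kfun_eq_mul_kOff i, kOff_update_right, RVec.update_apply_same]

/-- (Ported verbatim from the HodgeCMPerL package; no docstring in the source.) -/
theorem inner_tp_update_tp_update (x : RVec 𝓔) (i : ι) (v w : H i) :
    ⟪tp 𝓔 (x.update i v), tp 𝓔 (x.update i w)⟫_ℂ = ⟪v, w⟫_ℂ * kOff i x x := by
  rw [inner_tp_tp_update, RVec.update_apply_same, kOff_update_left]

variable (𝓔) in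
/-- The slot map `v ↦ ⊗ (x with x_i := v)` as a linear map. -/
def slotₗ (x : RVec 𝓔) (i : ι) : H i →ₗ[ℂ] Space 𝓔 where
  toFun v := tp 𝓔 (x.update i v)
  map_add' v w := ext_inner_tp fun y => by
    simp only [inner_add_right, inner_tp_tp_update, add_mul]
  map_smul' c v := ext_inner_tp fun y => by
    simp only [inner_smul_right, inner_tp_tp_update, RingHom.id_apply, mul_assoc]

/-- (Ported verbatim from the HodgeCMPerL package; no docstring in the source.) -/
@[simp] theorem slotₗ_apply (x : RVec 𝓔) (i : ι) (v : H i) :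
    slotₗ 𝓔 x i v = tp 𝓔 (x.update i v) := rfl

/-- (Ported verbatim from the HodgeCMPerL package; no docstring in the source.) -/
theorem norm_slotₗ_of_norm_eq_one (x : RVec 𝓔) (hx : ∀ j, ‖x j‖ = 1) (i : ι) (v : H i) :
    ‖slotₗ 𝓔 x i v‖ = ‖v‖ := by
  have h : ((‖slotₗ 𝓔 x i v‖ ^ 2 : ℝ) : ℂ) = ((‖v‖ ^ 2 : ℝ) : ℂ) := by
    have h1 : ⟪slotₗ 𝓔 x i v, slotₗ 𝓔 x i v⟫_ℂ = ((‖slotₗ 𝓔 x i v‖ ^ 2 : ℝ) : ℂ) := by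
      rw [inner_self_eq_norm_sq_to_K]; norm_cast
    have h2 : ⟪v, v⟫_ℂ = ((‖v‖ ^ 2 : ℝ) : ℂ) := by
      rw [inner_self_eq_norm_sq_to_K]; norm_cast
    rw [← h1, ← h2, slotₗ_apply, inner_tp_update_tp_update, kOff_self_of_norm_eq_one i x hx,
      mul_one]
  have h' : ‖slotₗ 𝓔 x i v‖ ^ 2 = ‖v‖ ^ 2 := by exact_mod_cast h
  exact (pow_left_inj₀ (norm_nonneg _) (norm_nonneg _) two_ne_zero).mp h'

variable (𝓔) in
/-- **The slot isometry** `H i →ₗᵢ[ℂ] ⊗′ H`, `v ↦ ⊗ (x with x_i := v)`, for a restricted family `x`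
of unit vectors. -/
def slot (x : RVec 𝓔) (hx : ∀ j, ‖x j‖ = 1) (i : ι) : H i →ₗᵢ[ℂ] Space 𝓔 :=
  { slotₗ 𝓔 x i with norm_map' := norm_slotₗ_of_norm_eq_one x hx i }

/-- (Ported verbatim from the HodgeCMPerL package; no docstring in the source.) -/
@[simp] theorem slot_apply (x : RVec 𝓔) (hx : ∀ j, ‖x j‖ = 1) (i : ι) (v : H i) :
    slot 𝓔 x hx i v = tp 𝓔 (x.update i v) := rfl

/-- (Ported verbatim from the HodgeCMPerL package; no docstring in the source.) -/
theorem slot_apply_self (x : RVec 𝓔) (hx : ∀ j, ‖x j‖ = 1) (i : ι) :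
    slot 𝓔 x hx i (x i) = tp 𝓔 x := by
  rw [slot_apply, RVec.update_eq_self]

end slot

/-- (Ported verbatim from the HodgeCMPerL package; no docstring in the source.) -/
theorem norm_tp_update [DecidableEq ι] (x : RVec 𝓔) (i : ι) (v : H i) :
    ‖tp 𝓔 (x.update i v)‖ = ‖v‖ * ∏ᶠ (j) (_ : j ≠ i), ‖x j‖ := by
  rw [norm_tp, ← mul_finprod_cond_ne i (hasFiniteMulSupport_norm (x.update i v)),
    RVec.update_apply_same]
  congr 1
  exact finprod_congr fun j => finprod_congr fun hj => by rw [RVec.update_apply_of_ne _ hj]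

/-- (Ported verbatim from the HodgeCMPerL package; no docstring in the source.) -/
theorem norm_tp_of_norm_eq_one (x : RVec 𝓔) (hx : ∀ j, ‖x j‖ = 1) : ‖tp 𝓔 x‖ = 1 := by
  rw [norm_tp]; exact finprod_eq_one_of_forall_eq_one hx

/-- (Ported verbatim from the HodgeCMPerL package; no docstring in the source.) -/
theorem continuous_slotₗ [DecidableEq ι] (x : RVec 𝓔) (i : ι) : Continuous (slotₗ 𝓔 x i) :=
  AddMonoidHomClass.continuous_of_bound (slotₗ 𝓔 x i) (∏ᶠ (j) (_ : j ≠ i), ‖x j‖) fun v => by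
    rw [slotₗ_apply, norm_tp_update, mul_comm]

/-! ## §4 The restricted-product representation `⊗′ ρ_i` -/

section action

variable {G : ι → Type*} [∀ i, Group (G i)] {Sub : ι → Type*} [∀ i, SetLike (Sub i) (G i)]
  {B : ∀ i, Sub i} {ρ : ∀ i, G i →* (H i ≃ₗᵢ[ℂ] H i)}

variable (𝓔) in
/-- Admissibility of local data `(ρ_i, B_i)` along `e`: `ρ_i(B_i)` fixes `e_i` for almost all `i`
(so that `Πʳ [G i, B i]` acts on restricted families). -/
def Admissible (B : ∀ i, Sub i) (ρ : ∀ i, G i →* (H i ≃ₗᵢ[ℂ] H i)) : Prop :=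
  ∀ᶠ i in cofinite, ∀ b ∈ B i, ρ i b (𝓔.e i) = 𝓔.e i

variable (hρ : Admissible 𝓔 B ρ)
include hρ

/-- (Ported verbatim from the HodgeCMPerL package; no docstring in the source.) -/
theorem Admissible.eventually_apply_e (g : Πʳ i, [G i, B i]) :
    ∀ᶠ i in cofinite, ρ i (g i) (𝓔.e i) = 𝓔.e i :=
  (g.2.and hρ).mono fun _ hi => hi.2 _ hi.1

/-- The action of `Πʳ [G i, B i]` on restricted families: `(g • x)_i = ρ_i(g_i) x_i`. -/
def gact (g : Πʳ i, [G i, B i]) (x : RVec 𝓔) : RVec 𝓔 :=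
  RVec.map (fun i => ρ i (g i)) (hρ.eventually_apply_e g) x

/-- (Ported verbatim from the HodgeCMPerL package; no docstring in the source.) -/
@[simp] theorem gact_apply (g : Πʳ i, [G i, B i]) (x : RVec 𝓔) (i : ι) :
    gact hρ g x i = ρ i (g i) (x i) := rfl

/-- (Ported verbatim from the HodgeCMPerL package; no docstring in the source.) -/
theorem kfun_gact (g : Πʳ i, [G i, B i]) (x y : RVec 𝓔) :
    kfun (gact hρ g x) (gact hρ g y) = kfun x y :=
  finprod_congr fun _ => LinearIsometryEquiv.inner_map_map _ _ _

/-- The action on formal combinations (push-forward along `gact`). -/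
def preAct (g : Πʳ i, [G i, B i]) : Pre 𝓔 →ₗ[ℂ] Pre 𝓔 := Finsupp.lmapDomain ℂ ℂ (gact hρ g)

/-- (Ported verbatim from the HodgeCMPerL package; no docstring in the source.) -/
theorem preAct_apply (g : Πʳ i, [G i, B i]) (f : Pre 𝓔) :
    preAct hρ g f = Finsupp.mapDomain (gact hρ g) f := rfl

omit hρ in
/-- (Ported verbatim from the HodgeCMPerL package; no docstring in the source.) -/
theorem sum_sum_mapDomain (φ : RVec 𝓔 → RVec 𝓔) (f f' : Pre 𝓔) (k : RVec 𝓔 → RVec 𝓔 → ℂ) :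
    ((Finsupp.mapDomain φ f).sum fun x a =>
      (Finsupp.mapDomain φ f').sum fun y b => conj a * b * k x y) =
      f.sum fun x a => f'.sum fun y b => conj a * b * k (φ x) (φ y) := by
  rw [Finsupp.sum_mapDomain_index]
  · refine Finsupp.sum_congr fun x _ => ?_
    rw [Finsupp.sum_mapDomain_index]
    · intro y; simp
    · intro y b₁ b₂; ring
  · intro x; simp
  · intro x a₁ a₂; simp only [map_add, add_mul, Finsupp.sum_add]

/-- (Ported verbatim from the HodgeCMPerL package; no docstring in the source.) -/
theorem inner_preAct (g : Πʳ i, [G i, B i]) (f f' : Pre 𝓔) :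
    ⟪preAct hρ g f, preAct hρ g f'⟫_ℂ = ⟪f, f'⟫_ℂ := by
  rw [inner_pre_def, inner_pre_def, preAct_apply, preAct_apply, sum_sum_mapDomain]
  exact Finsupp.sum_congr fun x _ => Finsupp.sum_congr fun y _ => by rw [kfun_gact]

/-- The action on formal combinations is isometric. -/
def preActₗᵢ (g : Πʳ i, [G i, B i]) : Pre 𝓔 →ₗᵢ[ℂ] Pre 𝓔 :=
  { preAct hρ g with
    norm_map' := fun f => by
      change ‖preAct hρ g f‖ = ‖f‖
      rw [norm_eq_sqrt_re_inner (𝕜 := ℂ), norm_eq_sqrt_re_inner (𝕜 := ℂ) f, inner_preAct] }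

/-- (Ported verbatim from the HodgeCMPerL package; no docstring in the source.) -/
@[simp] theorem preActₗᵢ_apply (g : Πʳ i, [G i, B i]) (f : Pre 𝓔) :
    preActₗᵢ hρ g f = preAct hρ g f := rfl

/-- The action of `g` on `⊗′ H`, as a continuous linear map (extension by continuity). -/
def actL (g : Πʳ i, [G i, B i]) : Space 𝓔 →L[ℂ] Space 𝓔 :=
  (preActₗᵢ hρ g).toContinuousLinearMap.completion

/-- (Ported verbatim from the HodgeCMPerL package; no docstring in the source.) -/
theorem actL_coe (g : Πʳ i, [G i, B i]) (f : Pre 𝓔) :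
    actL hρ g (f : Space 𝓔) = ((preAct hρ g f : Pre 𝓔) : Space 𝓔) :=
  ContinuousLinearMap.completion_apply_coe _ _

/-- (Ported verbatim from the HodgeCMPerL package; no docstring in the source.) -/
@[simp] theorem actL_tp (g : Πʳ i, [G i, B i]) (x : RVec 𝓔) :
    actL hρ g (tp 𝓔 x) = tp 𝓔 (gact hρ g x) := by
  rw [tp, actL_coe, preAct_apply, Finsupp.mapDomain_single]; rfl

/-- (Ported verbatim from the HodgeCMPerL package; no docstring in the source.) -/
theorem norm_actL (g : Πʳ i, [G i, B i]) (z : Space 𝓔) : ‖actL hρ g z‖ = ‖z‖ := by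
  refine UniformSpace.Completion.induction_on z
    (isClosed_eq (actL hρ g).continuous.norm continuous_norm) fun f => ?_
  rw [actL_coe, UniformSpace.Completion.norm_coe, UniformSpace.Completion.norm_coe]
  exact (preActₗᵢ hρ g).norm_map f

variable [∀ i, SubgroupClass (Sub i) (G i)]

/-- (Ported verbatim from the HodgeCMPerL package; no docstring in the source.) -/
theorem gact_one (x : RVec 𝓔) : gact hρ 1 x = x :=
  RVec.ext fun i => by simp [RestrictedProduct.one_apply]

/-- (Ported verbatim from the HodgeCMPerL package; no docstring in the source.) -/
theorem gact_mul (g h : Πʳ i, [G i, B i]) (x : RVec 𝓔) :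
    gact hρ (g * h) x = gact hρ g (gact hρ h x) :=
  RVec.ext fun i => by simp [RestrictedProduct.mul_apply]

/-- (Ported verbatim from the HodgeCMPerL package; no docstring in the source.) -/
theorem actL_one : actL hρ 1 = ContinuousLinearMap.id ℂ (Space 𝓔) :=
  clm_ext fun x => by rw [actL_tp, gact_one]; rfl

/-- (Ported verbatim from the HodgeCMPerL package; no docstring in the source.) -/
theorem actL_mul (g h : Πʳ i, [G i, B i]) : actL hρ (g * h) = (actL hρ g).comp (actL hρ h) :=
  clm_ext fun x => by simp only [ContinuousLinearMap.comp_apply, actL_tp, gact_mul]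

/-- (Ported verbatim from the HodgeCMPerL package; no docstring in the source.) -/
theorem actL_inv_actL (g : Πʳ i, [G i, B i]) (z : Space 𝓔) : actL hρ g⁻¹ (actL hρ g z) = z := by
  rw [← ContinuousLinearMap.comp_apply, ← actL_mul, inv_mul_cancel, actL_one]; rfl

/-- (Ported verbatim from the HodgeCMPerL package; no docstring in the source.) -/
theorem actL_actL_inv (g : Πʳ i, [G i, B i]) (z : Space 𝓔) : actL hρ g (actL hρ g⁻¹ z) = z := by
  rw [← ContinuousLinearMap.comp_apply, ← actL_mul, mul_inv_cancel, actL_one]; rfl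

/-- The action of `g` on `⊗′ H` as a unitary (linear isometric equivalence). -/
def repEquiv (g : Πʳ i, [G i, B i]) : Space 𝓔 ≃ₗᵢ[ℂ] Space 𝓔 :=
  { (actL hρ g).toLinearMap with
    invFun := actL hρ g⁻¹
    left_inv := actL_inv_actL hρ g
    right_inv := actL_actL_inv hρ g
    norm_map' := norm_actL hρ g }

/-- (Ported verbatim from the HodgeCMPerL package; no docstring in the source.) -/
@[simp] theorem repEquiv_apply (g : Πʳ i, [G i, B i]) (z : Space 𝓔) :
    repEquiv hρ g z = actL hρ g z := rfl

/-- **The restricted tensor product representation** `⊗′_i ρ_i : Πʳ [G i, B i] →* U(⊗′_i H_i)`. -/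
def rep : (Πʳ i, [G i, B i]) →* (Space 𝓔 ≃ₗᵢ[ℂ] Space 𝓔) where
  toFun := repEquiv hρ
  map_one' := LinearIsometryEquiv.ext fun z => by
    rw [repEquiv_apply, actL_one]; rfl
  map_mul' g h := LinearIsometryEquiv.ext fun z => by
    rw [repEquiv_apply, actL_mul]; rfl

/-- (Ported verbatim from the HodgeCMPerL package; no docstring in the source.) -/
theorem rep_apply (g : Πʳ i, [G i, B i]) (z : Space 𝓔) : rep hρ g z = actL hρ g z := rfl

/-- `(⊗′ρ)(g) (⊗ x_i) = ⊗ ρ_i(g_i) x_i`. -/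
@[simp] theorem rep_tp (g : Πʳ i, [G i, B i]) (x : RVec 𝓔) :
    rep hρ g (tp 𝓔 x) = tp 𝓔 (gact hρ g x) :=
  actL_tp hρ g x

/-- Matrix coefficients of pure tensors are the (finite) products of the local ones. -/
theorem inner_tp_rep_tp (g : Πʳ i, [G i, B i]) (x y : RVec 𝓔) :
    ⟪tp 𝓔 x, rep hρ g (tp 𝓔 y)⟫_ℂ = ∏ᶠ i, ⟪x i, ρ i (g i) (y i)⟫_ℂ := by
  rw [rep_tp, inner_tp_tp]; rfl

/-! ## §5 The S3-headline-shaped identities for `φ := ⊗ φ•`, `‖φ• i‖ = 1` -/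

omit hρ in
/-- `hφ`-shape: `‖⊗ φ•‖ = 1`. -/
theorem norm_tp_eq_one (φ : RVec 𝓔) (hφ : ∀ i, ‖φ i‖ = 1) : ‖tp 𝓔 φ‖ = 1 :=
  norm_tp_of_norm_eq_one φ hφ

/-- `hK`-shape: the box subgroup `K_T = {k : k_i ∈ B_i ∀ i, k_i = 1 ∀ i ∈ T}` fixes `⊗ φ•` as soon as
`ρ_i(B_i)` fixes `φ•_i` off `T`. -/
theorem rep_tp_eq_self_of_mem_boxSubgroup (φ : RVec 𝓔) {T : Finset ι}
    (hfix : ∀ i, i ∉ T → ∀ b ∈ B i, ρ i b (φ i) = φ i) {k : Πʳ i, [G i, B i]}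
    (hk : k ∈ RestrictedProduct.boxSubgroup B T) : rep hρ k (tp 𝓔 φ) = tp 𝓔 φ := by
  rw [rep_tp]
  congr 1
  refine RVec.ext fun i => ?_
  rw [gact_apply]
  obtain ⟨hkB, hkT⟩ := (RestrictedProduct.mem_boxSubgroup_iff T k).mp hk
  by_cases hi : i ∈ T
  · rw [hkT i hi, map_one]; rfl
  · exact hfix i hi _ (hkB i)

/-- The canonical local coefficient of `(⊗′ρ, ⊗φ•)` at `i` IS the local matrix coefficient
`⟪φ•_i, ρ_i(g) φ•_i⟫`. -/
theorem localCoeff_rep_tp [DecidableEq ι] (φ : RVec 𝓔) (hφ : ∀ i, ‖φ i‖ = 1) (i : ι) (g : G i) :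
    PureTensor.localCoeff B (rep hρ) (tp 𝓔 φ) i g = ⟪φ i, ρ i g (φ i)⟫_ℂ := by
  unfold PureTensor.localCoeff
  rw [inner_tp_rep_tp, finprod_eq_single _ i fun j hj => by
    rw [RestrictedProduct.coe_mulSingle_apply, Pi.mulSingle_eq_of_ne hj, map_one,
      LinearIsometryEquiv.coe_one, id_eq, inner_self_eq_norm_sq_to_K, hφ j]
    simp, RestrictedProduct.coe_mulSingle_apply, Pi.mulSingle_eq_same]

/-- `hM`-shape, pointwise: the matrix coefficient of `⊗ φ•` at `extendOne B S y = (y on S, 1 off S)`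
is the finite product of the local matrix coefficients over `S`. -/
theorem inner_tp_rep_extendOne_tp [DecidableEq ι] (φ : RVec 𝓔) (hφ : ∀ i, ‖φ i‖ = 1)
    (S : Finset ι) (y : (i : ↥S) → G i) :
    ⟪tp 𝓔 φ, rep hρ (PureTensor.extendOne B S y) (tp 𝓔 φ)⟫_ℂ =
      ∏ i : ↥S, ⟪φ i, ρ i (y i) (φ i)⟫_ℂ := by
  rw [inner_tp_rep_tp]
  have h1 : ∀ j, j ∉ S → ⟪φ j, ρ j (PureTensor.extendOne B S y j) (φ j)⟫_ℂ = 1 := fun j hj => by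
    rw [PureTensor.extendOne_apply_of_not_mem B S y hj, map_one, LinearIsometryEquiv.coe_one,
      id_eq, inner_self_eq_norm_sq_to_K, hφ j]
    simp
  rw [finprod_eq_prod_of_mulSupport_subset _ (s := S) fun j hj => by
      by_contra h; exact hj (h1 j (by simpa using h)),
    ← Finset.prod_coe_sort S]
  exact Finset.prod_congr rfl fun i _ => by
    rw [PureTensor.extendOne_apply_of_mem B S y i.2]

/-- `hM`-shape, verbatim: `⟪φ, ω(extendOne S y) φ⟫ = ∏_{i : S} localCoeff B ω φ i (y i)` for
`ω = ⊗′ρ`, `φ = ⊗ φ•`. -/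
theorem inner_tp_rep_extendOne_tp_eq_prod_localCoeff [DecidableEq ι] (φ : RVec 𝓔)
    (hφ : ∀ i, ‖φ i‖ = 1) (S : Finset ι) (y : (i : ↥S) → G i) :
    inner ℂ (tp 𝓔 φ) (rep hρ (PureTensor.extendOne B S y) (tp 𝓔 φ)) =
      ∏ i : ↥S, PureTensor.localCoeff B (rep hρ) (tp 𝓔 φ) i (y i) := by
  rw [inner_tp_rep_extendOne_tp hρ φ hφ]
  exact Finset.prod_congr rfl fun i _ => (localCoeff_rep_tp hρ φ hφ i (y i)).symm

/-- The action of a basic element `ι_i(g)` on a pure tensor changes only the `i`-th slot. -/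
theorem gact_mulSingle_update [DecidableEq ι] (x : RVec 𝓔) (i : ι) (g : G i) (v : H i) :
    gact hρ (RestrictedProduct.mulSingle B i g) (x.update i v) = x.update i (ρ i g v) := by
  refine RVec.ext fun j => ?_
  rw [gact_apply, RestrictedProduct.coe_mulSingle_apply]
  by_cases hj : j = i
  · subst hj; rw [Pi.mulSingle_eq_same, RVec.update_apply_same, RVec.update_apply_same]
  · rw [Pi.mulSingle_eq_of_ne hj, RVec.update_apply_of_ne _ hj, RVec.update_apply_of_ne _ hj,
      map_one]; rfl

/-- `ι_i(g)` acts on `⊗ x` through the `i`-th slot. -/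
theorem rep_mulSingle_tp [DecidableEq ι] (x : RVec 𝓔) (i : ι) (g : G i) :
    rep hρ (RestrictedProduct.mulSingle B i g) (tp 𝓔 x) = slotₗ 𝓔 x i (ρ i g (x i)) := by
  rw [rep_tp, slotₗ_apply, ← gact_mulSingle_update hρ x i g (x i), RVec.update_eq_self]

/-- **Slot intertwining** (`hVU`/`hVS`-shape): `ω(ι_i g) ∘ V_i = V_i ∘ ρ_i(g)` for the slot map
`V_i = slotₗ x i`. -/
theorem rep_mulSingle_slotₗ [DecidableEq ι] (x : RVec 𝓔) (i : ι) (g : G i) (v : H i) :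
    rep hρ (RestrictedProduct.mulSingle B i g) (slotₗ 𝓔 x i v) = slotₗ 𝓔 x i (ρ i g v) := by
  rw [slotₗ_apply, slotₗ_apply, rep_tp, gact_mulSingle_update]

/-- **Slot intertwining for the isometric slot** `V_i = slot φ• i : H i →ₗᵢ[ℂ] ⊗′H` (the fields
`hVU`, `hVS` of `GenuineThetaInput`, given local data): `ω(ι_i g) (V_i v) = V_i (ρ_i(g) v)`, and
`V_i (φ•_i) = φ` (`hVUψ`, `hVSψ`). -/
theorem rep_mulSingle_slot [DecidableEq ι] (φ : RVec 𝓔) (hφ : ∀ i, ‖φ i‖ = 1) (i : ι) (g : G i)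
    (v : H i) :
    rep hρ (RestrictedProduct.mulSingle B i g) (slot 𝓔 φ hφ i v) = slot 𝓔 φ hφ i (ρ i g v) :=
  rep_mulSingle_slotₗ hρ φ i g v

/-- `hiso`-shape: if `ρ_i(g)` acts on `φ•_i` by the scalar `c`, then `ω(ι_i g)` acts on `⊗ φ•` by
`c`. -/
theorem rep_mulSingle_tp_of_smul [DecidableEq ι] (x : RVec 𝓔) (i : ι) (g : G i) (c : ℂ)
    (h : ρ i g (x i) = c • x i) :
    rep hρ (RestrictedProduct.mulSingle B i g) (tp 𝓔 x) = c • tp 𝓔 x := by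
  rw [rep_mulSingle_tp, h, map_smul, slotₗ_apply, RVec.update_eq_self]

/-- `hloc`-shape: **strong continuity of `g ↦ ω(ι_i g) v` from local strong continuity.** -/
theorem continuous_rep_mulSingle [DecidableEq ι] (i : ι) [TopologicalSpace (G i)]
    (hcont : ∀ w : H i, Continuous fun g : G i => ρ i g w) (v : Space 𝓔) :
    Continuous fun g : G i => rep hρ (RestrictedProduct.mulSingle B i g) v := by
  -- the set of good vectors is a submodule containing the pure tensors, hence dense ...
  let M : Submodule ℂ (Space 𝓔) :=
    { carrier := {v | Continuous fun g : G i => rep hρ (RestrictedProduct.mulSingle B i g) v}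
      add_mem' := fun {a b} ha hb => by
        simp only [Set.mem_setOf_eq, map_add] at ha hb ⊢
        exact ha.add hb
      zero_mem' := by simp only [Set.mem_setOf_eq, map_zero]; exact continuous_const
      smul_mem' := fun c a ha => by
        simp only [Set.mem_setOf_eq, map_smul] at ha ⊢
        exact ha.const_smul c }
  have hM : Submodule.span ℂ (Set.range (tp 𝓔)) ≤ M := by
    refine Submodule.span_le.mpr ?_
    rintro _ ⟨x, rfl⟩
    show Continuous fun g : G i => rep hρ (RestrictedProduct.mulSingle B i g) (tp 𝓔 x)
    simp only [rep_mulSingle_tp]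
    exact (continuous_slotₗ x i).comp (hcont (x i))
  have hdense : Dense (M : Set (Space 𝓔)) := dense_span_tp.mono hM
  -- ... and it is closed under uniform approximation, the operators being isometries.
  refine continuous_of_uniform_approx_of_continuous fun u hu => ?_
  obtain ⟨ε, hε, hεu⟩ := Metric.mem_uniformity_dist.mp hu
  obtain ⟨w, hwM, hw⟩ := hdense.exists_dist_lt v hε
  refine ⟨fun g : G i => rep hρ (RestrictedProduct.mulSingle B i g) w, hwM, fun g => hεu ?_⟩
  rw [dist_eq_norm, ← map_sub, LinearIsometryEquiv.norm_map, ← dist_eq_norm]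
  exact hw

end action

end HodgeCM.PerL34.RestrictedTensor

-- port_pkg: scope closed for this part
end
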